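/-
Copyright (c) 2026 the pub-hodgecm-mathlib formalisation cell (harness21).  Prover seat hodgecm-mathlib-K2Liu-p11 (g3), Track B «K2-LIT»,
#184♮ = hLiu418 = `stmt-HodgeConjecture-24832`; #41 G6-arch (A∞) general `K_w`-type, piece (H2-an) FILE 1: THE DOMINATED SWAP LEMMA for the archimedean
intertwining integral, for ANY majorised pair `(F, D)` (the analytic half of ★ (H2-alg) `rung_step`'s swap binder).
THEOREMS ONLY (no `def`, no `instance`, no notation, no named-fact hypothesis, no `sorry`).
-/
import Summits.HodgeConjecture.HodgeConjecture.Theorems.K2LiuArchIntertwiningLieDerivative   -- ★ (A) p16: brings ★ Prelims (L-i), ★ Majorant (L-ii), ★ ResolventBounds, tube defs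
import HarnessLib

/-!
# Crux `HLiu418`, G6-arch (A∞), (H2-an) FILE 1: `M_w` COMMUTES WITH `d∕dt` ALONG A `U(J)`-VALUED CURVE FOR EVERY MAJORISED PAIR `(F, D)`

Cell `hodgecm-mathlib`, crux item hLiu418 = `stmt-HodgeConjecture-24832` (helper lane `--supports`, count-neutral); squad K2 ∕ K2Liu, prover K2Liu-p11 (g3).

★ (A) `integrable_and_hasDerivAt_archIntertwining` (K2E5-p16) swaps `d∕dt` and `M_w(s) = ∫_{Herm₂}` for the scalar-type vector `f⁰_{s,k}` ONLY (its derivative is written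
out).  The `K_w`-type ladder (★ (H2-alg) `K2LiuArchIntertwiningKTypeLadder.rung_step`) needs the swap on EVERY rung `F` (a `K_w`-finite section of `I_w(s, χ_k)`), whose only
usable property is the MAJORATION `‖F(y)‖ ≤ C_F · ‖j(y, i1)‖^{−(2σ+2)}` on `U(J)` (`σ = re s`; every `K_w`-finite section is `O(f⁰_{σ,·})`, FILE 2).  This file proves the
swap ABSTRACTLY:

**`integrable_and_hasDerivAt_archIntertwining_of_dominated`.**  Let `re s > ½`, `g ∈ U(J)`, `γ : ℝ → U(J)` continuous with `γ 0 = 1`, and `F, D : M₄(ℂ) → ℂ` continuous on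
`U(J)` with `‖F(y)‖ ≤ C_F ‖j(y,i1)‖^{−(2σ+2)}`, `‖D(y)‖ ≤ C_D ‖j(y,i1)‖^{−(2σ+2)}` on `U(J)` and `HasDerivAt (t ↦ F(y γ_t)) (D(y γ_t)) t` for all `y ∈ U(J)`, `t`.
Then `r ↦ D(J n(hermOfReal r) g)` is integrable and **`t ↦ M_w F (g γ_t)` has derivative `M_w D (g)` at `0`**.
PROOF = ★ (A)'s skeleton with the explicit kernel replaced by the majoration: dominated differentiation (Mathlib `hasDerivAt_integral_of_dominated_loc_of_deriv_le`) on the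
good set `{‖(Z_t − Z_0)ᵢⱼ‖ ≤ η, ‖j(gγ_t, i1)‖ ≥ δ₀}` (`Z_t = gγ_t·i1`), where `j(J n(X) gγ_t, i1) = det((X + Z_t)·j(gγ_t,i1))` (★ `denom_transl_eq_mul`),
`‖det(X + Z_0)‖ ≤ 4‖det(X + Z_t)‖` uniformly in Hermitian `X` (★ `exists_resolvent_perturb`), so the majorant is `C_D·4^a·δ₀^{−a}·‖det(hermOfReal r + Z_0)‖^{−a}`, `a = 2σ+2 > 3`,
integrable by ★ `integrable_norm_det_hermOfReal_add_rpow_neg`.  Also `integrable_of_dominated` (absolute convergence of `M_w F (g)` for a majorised `F`).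
FILE 2 (`K2LiuArchKFiniteSectionMajorised`) discharges the five hypotheses for `K_w`-finite sections and `γ_t = exp(tX)`, `X ∈ 𝔲(J)`.
References: [Knapp1986, Ch. VII §§3–4]; [Shimura1997, §16.4]; [Shimura1982, §1 (1.26)]; [LeeZhu1998, §5].
HONEST LABEL: HC_CM is proved only modulo the 7 printed citations (2 remaining named inputs: hLiu418 = stmt-HodgeConjecture-24832,
h413 = stmt-HodgeConjecture-24833) until rung 0 closes; count-neutral helper, closes no socket.
-/

set_option autoImplicit false
set_option linter.dupNamespace false

noncomputable section

open Complex Matrix MeasureTheory Filter NormedSpace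
open scoped ComplexConjugate ComplexOrder Topology

namespace Summit.HodgeConjecture.HodgeConjecture.Cruxes.HLiu418.K2LiuArchIntertwiningDominatedSwap

open Literature.NumberTheory.ModularForms.SiegelUpperHalfSpace (num denom moeb num_def denom_def moeb_def moeb_mul_denom)
open Summit.HodgeConjecture.HodgeConjecture.Cruxes.HLiu418.K2LiuHermTwoGammaDefs
open Summit.HodgeConjecture.HodgeConjecture.Cruxes.HLiu418.K2LiuHermitianTubeCocycle (mul_mem_UJ J_mem isUnit_det_denom posDef_im_moeb
  posDef_im_I_smul_one isHermitian_re re_add_I_smul_im)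
open Summit.HodgeConjecture.HodgeConjecture.Cruxes.HLiu418.K2LiuArchInducedTubeDefs
open Summit.HodgeConjecture.HodgeConjecture.Cruxes.HLiu418.K2LiuArchIntertwiningMajorant
open Summit.HodgeConjecture.HodgeConjecture.Cruxes.HLiu418.K2LiuHermTwoResolventBounds
open Summit.HodgeConjecture.HodgeConjecture.Cruxes.HLiu418.K2LiuArchIntertwiningLieDerivativePrelims

/-! ## §1  Absolute convergence of `M_w F (h)` for a majorised `F` -/

/-- **`M_w F (h)` converges absolutely for a majorised `F`**: if `F` is continuous on `U(J)` with `‖F(y)‖ ≤ C·‖j(y,i1)‖^{−(2σ+2)}` there (`σ > ½`), then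
`r ↦ F(J n(hermOfReal r) h)` is integrable for every `h ∈ U(J)`. [Shimura1982, §1 (1.26)] [Shimura1997, §16.4] -/
theorem integrable_of_dominated {σ : ℝ} (hσ : 1 / 2 < σ)
    {h : Matrix (Fin 2 ⊕ Fin 2) (Fin 2 ⊕ Fin 2) ℂ} (hh : hᴴ * Matrix.J (Fin 2) ℂ * h = Matrix.J (Fin 2) ℂ)
    (F : Matrix (Fin 2 ⊕ Fin 2) (Fin 2 ⊕ Fin 2) ℂ → ℂ)
    (hFc : ContinuousOn F {y | yᴴ * Matrix.J (Fin 2) ℂ * y = Matrix.J (Fin 2) ℂ})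
    {C : ℝ} (hFb : ∀ y : Matrix (Fin 2 ⊕ Fin 2) (Fin 2 ⊕ Fin 2) ℂ, yᴴ * Matrix.J (Fin 2) ℂ * y = Matrix.J (Fin 2) ℂ →
      ‖F y‖ ≤ C * ‖(denom y (I • (1 : Matrix (Fin 2) (Fin 2) ℂ))).det‖ ^ (-(2 * σ + 2))) :
    Integrable (fun r : Fin 2 → Fin 2 → ℝ => F (Matrix.J (Fin 2) ℂ * fromBlocks 1 (hermOfReal r) 0 1 * h)) := by
  have ha3 : 3 < 2 * σ + 2 := by linarith
  -- the tube point `Z = h·i1 = U₀ + iV₀` and `d = j(h, i1)`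
  set Z : Matrix (Fin 2) (Fin 2) ℂ := moeb h (I • (1 : Matrix (Fin 2) (Fin 2) ℂ)) with hZ
  set d : Matrix (Fin 2) (Fin 2) ℂ := denom h (I • (1 : Matrix (Fin 2) (Fin 2) ℂ)) with hd
  have hdu : IsUnit d.det := isUnit_det_denom hh posDef_im_I_smul_one
  set U₀ : Matrix (Fin 2) (Fin 2) ℂ := (2 : ℂ)⁻¹ • (Z + Zᴴ) with hU₀
  set V₀ : Matrix (Fin 2) (Fin 2) ℂ := (2 * I)⁻¹ • (Z - Zᴴ) with hV₀
  have hU₀h : U₀.IsHermitian := isHermitian_re Z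
  have hV₀p : V₀.PosDef := posDef_im_moeb hh posDef_im_I_smul_one
  have hZ₀ : U₀ + I • V₀ = Z := re_add_I_smul_im Z
  -- measurability
  have hmeas : AEStronglyMeasurable (fun r : Fin 2 → Fin 2 → ℝ => F (Matrix.J (Fin 2) ℂ * fromBlocks 1 (hermOfReal r) 0 1 * h)) volume :=
    (hFc.comp_continuous (continuous_transl_mul h) fun r => mul_mem_UJ (J_mul_transl_hermOfReal_mem r) hh).aestronglyMeasurable
  -- the majorant
  have hmaj : Integrable (fun r : Fin 2 → Fin 2 → ℝ => ‖(hermOfReal r + Z).det‖ ^ (-(2 * σ + 2))) := by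
    have h1 := integrable_norm_det_hermOfReal_add_rpow_neg hU₀h hV₀p ha3
    rw [hZ₀] at h1
    exact h1
  refine Integrable.mono' ((hmaj.const_mul (‖d.det‖ ^ (-(2 * σ + 2)))).const_mul C) hmeas (Eventually.of_forall fun r => ?_)
  have hy := mul_mem_UJ (J_mul_transl_hermOfReal_mem r) hh
  have hΔ : denom (Matrix.J (Fin 2) ℂ * fromBlocks 1 (hermOfReal r) 0 1 * h) (I • (1 : Matrix (Fin 2) (Fin 2) ℂ)) = (hermOfReal r + Z) * d :=
    denom_transl_eq_mul (hermOfReal r) hdu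
  refine (hFb _ hy).trans (le_of_eq ?_)
  rw [hΔ, det_mul, norm_mul, Real.mul_rpow (norm_nonneg _) (norm_nonneg _)]
  ring

/-! ## §2  The dominated swap lemma -/

/-- **THE DOMINATED SWAP LEMMA** (see the module docstring): `M_w` commutes with `d∕dt` along a continuous `U(J)`-valued curve `γ` (`γ 0 = 1`) for every pair
`(F, D)` continuous on `U(J)`, majorised by `‖j(·, i1)‖^{−(2σ+2)}` there, with `d∕dt F(y γ_t) = D(y γ_t)` (`y ∈ U(J)`); `re s = σ > ½`.
[Knapp1986, Ch. VII §3] [Shimura1997, §16.4] [Shimura1982, §1 (1.26)] -/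
theorem integrable_and_hasDerivAt_archIntertwining_of_dominated {σ : ℝ} (hσ : 1 / 2 < σ)
    {g : Matrix (Fin 2 ⊕ Fin 2) (Fin 2 ⊕ Fin 2) ℂ} (hg : gᴴ * Matrix.J (Fin 2) ℂ * g = Matrix.J (Fin 2) ℂ)
    {γ : ℝ → Matrix (Fin 2 ⊕ Fin 2) (Fin 2 ⊕ Fin 2) ℂ} (hγ0 : γ 0 = 1) (hγc : Continuous γ)
    (hγU : ∀ t, (γ t)ᴴ * Matrix.J (Fin 2) ℂ * γ t = Matrix.J (Fin 2) ℂ)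
    (F D : Matrix (Fin 2 ⊕ Fin 2) (Fin 2 ⊕ Fin 2) ℂ → ℂ)
    (hFc : ContinuousOn F {y | yᴴ * Matrix.J (Fin 2) ℂ * y = Matrix.J (Fin 2) ℂ})
    (hDc : ContinuousOn D {y | yᴴ * Matrix.J (Fin 2) ℂ * y = Matrix.J (Fin 2) ℂ})
    {CF CD : ℝ} (hCD : 0 ≤ CD)
    (hFb : ∀ y : Matrix (Fin 2 ⊕ Fin 2) (Fin 2 ⊕ Fin 2) ℂ, yᴴ * Matrix.J (Fin 2) ℂ * y = Matrix.J (Fin 2) ℂ →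
      ‖F y‖ ≤ CF * ‖(denom y (I • (1 : Matrix (Fin 2) (Fin 2) ℂ))).det‖ ^ (-(2 * σ + 2)))
    (hDb : ∀ y : Matrix (Fin 2 ⊕ Fin 2) (Fin 2 ⊕ Fin 2) ℂ, yᴴ * Matrix.J (Fin 2) ℂ * y = Matrix.J (Fin 2) ℂ →
      ‖D y‖ ≤ CD * ‖(denom y (I • (1 : Matrix (Fin 2) (Fin 2) ℂ))).det‖ ^ (-(2 * σ + 2)))
    (hFD : ∀ y : Matrix (Fin 2 ⊕ Fin 2) (Fin 2 ⊕ Fin 2) ℂ, yᴴ * Matrix.J (Fin 2) ℂ * y = Matrix.J (Fin 2) ℂ →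
      ∀ t : ℝ, HasDerivAt (fun t : ℝ => F (y * γ t)) (D (y * γ t)) t) :
    Integrable (fun r : Fin 2 → Fin 2 → ℝ => D (Matrix.J (Fin 2) ℂ * fromBlocks 1 (hermOfReal r) 0 1 * g)) ∧
      HasDerivAt (fun t : ℝ => archIntertwining F (g * γ t)) (archIntertwining D g) 0 := by
  have ha : 0 ≤ 2 * σ + 2 := by linarith
  have ha3 : 3 < 2 * σ + 2 := by linarith
  -- (1) the curve data
  have hgγ : ∀ t, (g * γ t)ᴴ * Matrix.J (Fin 2) ℂ * (g * γ t) = Matrix.J (Fin 2) ℂ := fun t => mul_mem_UJ hg (hγU t)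
  have hh : Continuous fun t => g * γ t := continuous_const.mul hγc
  obtain ⟨d, hd⟩ : ∃ d : ℝ → Matrix (Fin 2) (Fin 2) ℂ, d = fun t => denom (g * γ t) (I • (1 : Matrix (Fin 2) (Fin 2) ℂ)) := ⟨_, rfl⟩
  obtain ⟨Z, hZ⟩ : ∃ Z : ℝ → Matrix (Fin 2) (Fin 2) ℂ, Z = fun t => moeb (g * γ t) (I • (1 : Matrix (Fin 2) (Fin 2) ℂ)) := ⟨_, rfl⟩
  have hdu : ∀ t, IsUnit (d t).det := fun t => by rw [hd]; exact isUnit_det_denom (hgγ t) posDef_im_I_smul_one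
  have hd_cont : Continuous d := by rw [hd]; exact (continuous_denom _).comp hh
  have hd0 : (d 0).det ≠ 0 := (hdu 0).ne_zero
  have hdet_cont : ContinuousAt (fun t => (d t).det) 0 := hd_cont.matrix_det.continuousAt
  have hdinv_cont : ContinuousAt (fun t => (d t)⁻¹) 0 := by
    have hA := continuousAt_matrix_inv (d 0) (by rw [Ring.inverse_eq_inv']; exact continuousAt_inv₀ hd0)
    exact ContinuousAt.comp (g := Inv.inv) hA hd_cont.continuousAt
  have hZ_cont : ContinuousAt Z 0 := by
    have hn : Continuous fun t => num (g * γ t) (I • (1 : Matrix (Fin 2) (Fin 2) ℂ)) := (continuous_num _).comp hh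
    have h := hn.continuousAt.mul hdinv_cont
    rw [hZ]
    simp only [moeb_def, hd] at h ⊢
    exact h
  -- (2) the tube point `Z 0 = U₀ + iV₀` and the resolvent constants
  set U₀ : Matrix (Fin 2) (Fin 2) ℂ := (2 : ℂ)⁻¹ • (Z 0 + (Z 0)ᴴ) with hU₀
  set V₀ : Matrix (Fin 2) (Fin 2) ℂ := (2 * I)⁻¹ • (Z 0 - (Z 0)ᴴ) with hV₀
  have hU₀h : U₀.IsHermitian := isHermitian_re (Z 0)
  have hV₀p : V₀.PosDef := by
    have h : ((2 * I)⁻¹ • (moeb (g * γ 0) (I • (1 : Matrix (Fin 2) (Fin 2) ℂ)) - (moeb (g * γ 0) (I • (1 : Matrix (Fin 2) (Fin 2) ℂ)))ᴴ)).PosDef :=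
      posDef_im_moeb (hgγ 0) posDef_im_I_smul_one
    rw [hV₀, hZ]
    exact h
  have hZ₀ : U₀ + I • V₀ = Z 0 := re_add_I_smul_im (Z 0)
  obtain ⟨c₀, C₁, hc₀, -, hres₀⟩ := exists_resolvent_bound hU₀h hV₀p
  obtain ⟨η, C, hη, -, hres⟩ := exists_resolvent_perturb hU₀h hV₀p
  -- (3) the good set
  set δ₀ : ℝ := ‖(d 0).det‖ / 2 with hδ₀
  have hδ₀pos : 0 < δ₀ := by have := norm_pos_iff.mpr hd0; positivity
  have hgood : ∀ᶠ t in 𝓝 (0 : ℝ), (∀ i j, ‖(Z t - Z 0) i j‖ ≤ η) ∧ δ₀ ≤ ‖(d t).det‖ := by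
    filter_upwards [eventually_norm_sub_apply_le hZ_cont hη, eventually_half_norm_le hdet_cont hd0] with t h1 h2
    exact ⟨h1, h2⟩
  have hkey : ∀ t : ℝ, ((∀ i j, ‖(Z t - Z 0) i j‖ ≤ η) ∧ δ₀ ≤ ‖(d t).det‖) → ∀ X : Matrix (Fin 2) (Fin 2) ℂ, X.IsHermitian →
      ‖(X + Z 0).det‖ ≤ 4 * ‖(X + Z t).det‖ ∧ 0 < ‖(X + Z 0).det‖ := by
    intro t ht X hX
    have hE := hres X (Z t - Z 0) hX ht.1
    have hsum : X + (U₀ + I • V₀) + (Z t - Z 0) = X + Z t := by rw [hZ₀]; abel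
    rw [hsum, hZ₀] at hE
    have h0 : 0 < ‖(X + Z 0).det‖ := by
      have h := (hres₀ X hX).1
      rw [hZ₀] at h
      exact hc₀.trans_le h
    exact ⟨hE.1, h0⟩
  -- (4) the integrands and the majorant
  obtain ⟨Φ, hΦ⟩ : ∃ Φ : ℝ → (Fin 2 → Fin 2 → ℝ) → ℂ,
      Φ = fun t r => F (Matrix.J (Fin 2) ℂ * fromBlocks 1 (hermOfReal r) 0 1 * (g * γ t)) := ⟨_, rfl⟩
  obtain ⟨Φ', hΦ'⟩ : ∃ Φ' : ℝ → (Fin 2 → Fin 2 → ℝ) → ℂ,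
      Φ' = fun t r => D (Matrix.J (Fin 2) ℂ * fromBlocks 1 (hermOfReal r) 0 1 * (g * γ t)) := ⟨_, rfl⟩
  obtain ⟨bound, hbound⟩ : ∃ bound : (Fin 2 → Fin 2 → ℝ) → ℝ, bound = fun r =>
      CD * ((4 : ℝ) ^ (2 * σ + 2) * δ₀ ^ (-(2 * σ + 2)) * ‖(hermOfReal r + Z 0).det‖ ^ (-(2 * σ + 2))) := ⟨_, rfl⟩
  have hmaj : Integrable (fun r : Fin 2 → Fin 2 → ℝ => ‖(hermOfReal r + Z 0).det‖ ^ (-(2 * σ + 2))) := by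
    have h := integrable_norm_det_hermOfReal_add_rpow_neg hU₀h hV₀p ha3
    rw [hZ₀] at h
    exact h
  have hbound_int : Integrable bound := by
    rw [hbound]
    exact (hmaj.const_mul _).const_mul _
  -- the factorisation `j(J n(X) g γ_t, i1) = (X + Z_t)·d_t` and the pointwise estimate on the good set
  have hΔ : ∀ (t : ℝ) (X : Matrix (Fin 2) (Fin 2) ℂ),
      denom (Matrix.J (Fin 2) ℂ * fromBlocks 1 X 0 1 * (g * γ t)) (I • (1 : Matrix (Fin 2) (Fin 2) ℂ)) = (X + Z t) * d t := by
    intro t X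
    have h := denom_transl_eq_mul X (h := g * γ t) (by have := hdu t; rw [hd] at this; exact this)
    rw [hZ, hd]
    exact h
  have hjest : ∀ t : ℝ, ((∀ i j, ‖(Z t - Z 0) i j‖ ≤ η) ∧ δ₀ ≤ ‖(d t).det‖) → ∀ r : Fin 2 → Fin 2 → ℝ,
      ‖(denom (Matrix.J (Fin 2) ℂ * fromBlocks 1 (hermOfReal r) 0 1 * (g * γ t)) (I • (1 : Matrix (Fin 2) (Fin 2) ℂ))).det‖ ^ (-(2 * σ + 2)) ≤
        (4 : ℝ) ^ (2 * σ + 2) * δ₀ ^ (-(2 * σ + 2)) * ‖(hermOfReal r + Z 0).det‖ ^ (-(2 * σ + 2)) := by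
    intro t ht r
    obtain ⟨h4, h0⟩ := hkey t ht _ (isHermitian_hermOfReal r)
    rw [hΔ, det_mul, norm_mul, Real.mul_rpow (norm_nonneg _) (norm_nonneg _)]
    have h1 : ‖(hermOfReal r + Z t).det‖ ^ (-(2 * σ + 2)) ≤ (4 : ℝ) ^ (2 * σ + 2) * ‖(hermOfReal r + Z 0).det‖ ^ (-(2 * σ + 2)) :=
      rpow_neg_le_of_le_four_mul h0 h4 ha
    have h2 : ‖(d t).det‖ ^ (-(2 * σ + 2)) ≤ δ₀ ^ (-(2 * σ + 2)) := Real.rpow_le_rpow_of_nonpos hδ₀pos ht.2 (by linarith)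
    calc ‖(hermOfReal r + Z t).det‖ ^ (-(2 * σ + 2)) * ‖(d t).det‖ ^ (-(2 * σ + 2))
        ≤ ((4 : ℝ) ^ (2 * σ + 2) * ‖(hermOfReal r + Z 0).det‖ ^ (-(2 * σ + 2))) * δ₀ ^ (-(2 * σ + 2)) :=
          mul_le_mul h1 h2 (Real.rpow_nonneg (norm_nonneg _) _) (by positivity)
      _ = (4 : ℝ) ^ (2 * σ + 2) * δ₀ ^ (-(2 * σ + 2)) * ‖(hermOfReal r + Z 0).det‖ ^ (-(2 * σ + 2)) := by ring
  -- (5) the six hypotheses of dominated differentiation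
  have hmemr : ∀ (t : ℝ) (r : Fin 2 → Fin 2 → ℝ),
      (Matrix.J (Fin 2) ℂ * fromBlocks 1 (hermOfReal r) 0 1 * (g * γ t))ᴴ * Matrix.J (Fin 2) ℂ *
        (Matrix.J (Fin 2) ℂ * fromBlocks 1 (hermOfReal r) 0 1 * (g * γ t)) = Matrix.J (Fin 2) ℂ :=
    fun t r => mul_mem_UJ (J_mul_transl_hermOfReal_mem r) (hgγ t)
  have hF_meas : ∀ᶠ t in 𝓝 (0 : ℝ), AEStronglyMeasurable (Φ t) volume := by
    refine Eventually.of_forall fun t => ?_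
    rw [hΦ]
    exact (hFc.comp_continuous (continuous_transl_mul (g * γ t)) fun r => hmemr t r).aestronglyMeasurable
  have hF'_meas : AEStronglyMeasurable (Φ' 0) volume := by
    rw [hΦ']
    exact (hDc.comp_continuous (continuous_transl_mul (g * γ 0)) fun r => hmemr 0 r).aestronglyMeasurable
  have hgood0 := hgood.self_of_nhds
  have hF_int : Integrable (Φ 0) volume := by
    rw [hΦ]
    exact integrable_of_dominated hσ (hgγ 0) F hFc hFb
  have h_bound : ∀ᵐ r ∂(volume : Measure (Fin 2 → Fin 2 → ℝ)), ∀ t ∈ {t : ℝ | (∀ i j, ‖(Z t - Z 0) i j‖ ≤ η) ∧ δ₀ ≤ ‖(d t).det‖},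
      ‖Φ' t r‖ ≤ bound r := by
    refine Eventually.of_forall fun r t ht => ?_
    rw [hΦ', hbound]
    exact (hDb _ (hmemr t r)).trans (mul_le_mul_of_nonneg_left (hjest t ht r) hCD)
  have h_diff : ∀ᵐ r ∂(volume : Measure (Fin 2 → Fin 2 → ℝ)), ∀ t ∈ {t : ℝ | (∀ i j, ‖(Z t - Z 0) i j‖ ≤ η) ∧ δ₀ ≤ ‖(d t).det‖},
      HasDerivAt (fun t => Φ t r) (Φ' t r) t := by
    refine Eventually.of_forall fun r t _ => ?_
    have h := hFD (Matrix.J (Fin 2) ℂ * fromBlocks 1 (hermOfReal r) 0 1 * g) (mul_mem_UJ (J_mul_transl_hermOfReal_mem r) hg) t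
    rw [hΦ, hΦ']
    simp only [Matrix.mul_assoc] at h ⊢
    exact h
  -- (6) dominated differentiation
  have hmain := hasDerivAt_integral_of_dominated_loc_of_deriv_le hgood hF_meas hF_int hF'_meas h_bound hbound_int h_diff
  refine ⟨?_, ?_⟩
  · have h1 := hmain.1
    rw [hΦ'] at h1
    simpa only [hγ0, Matrix.mul_one] using h1
  · have h2 := hmain.2
    rw [hΦ, hΦ'] at h2
    simp only [hγ0, Matrix.mul_one] at h2
    rw [archIntertwining_apply]
    exact h2

end Summit.HodgeConjecture.HodgeConjecture.Cruxes.HLiu418.K2LiuArchIntertwiningDominatedSwap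

end
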